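import Literature.AnabelianGeometry.EtaleTheta.Discharge.Sec5JunctionClosureRange
import Literature.AnabelianGeometry.EtaleTheta.ThetaTwistTowerComapMuTorsion

/-!
# [EtTh] Prop. 4.2 (iii) AS TYPED — POSITIVE IN THE TRUE GROUP-SIDE SHAPE: at the theta tower restricted to a tempered subgroup `G ≤ Compat₃′`
# (dense `φ : Π^tp_X → G`), in particular at `settingClosureRange` for an ARBITRARY continuous `φ : Π^tp_X → Compat₃′` — modulo the displayed
# level-exhaustion clause (LEV) (Def. 4.1 pp.312–313, Prop. 4.2 (iii) pp.314–316 / PDF pp.86–90)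

S. Mochizuki, *The étale theta function …*, Publ. RIMS **45** (2009) [MochizukiEtTh2009], Def. 4.1 (i)(ii)(iv) pp.312–313 (PDF pp.86–87), Prop. 4.2
(iii) pp.314–316 (PDF pp.88–90) [cite: MochizukiEtTh2009, Prop 4.2 (iii) p.314 (PDF p.88)]; [FrdI] Thm. 5.2 p.100–101, Prop. 4.1 (iii) p.74; [FrdII]
Def. 2.1 (i) p.16, Rmk. 2.2.1 p.18; [SemiAnbd] Rmk. 3.1.2–3.1.3 pp.33–34.  PAGE CONVENTION for [EtTh]: «printed N (PDF p.M)», N = M + 226.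

abc-iut cell, layer L2, seat abc-iut-L2-t3 (gen 10; [EtTh] §3/§4 lineage), row «P42III@CLOSURE-RANGE» — the sequel of «P42III@SMALL-INDEX» at the
junction carrier a genuine `φ` can enter ((α) p504894, (β2-A) p507623, (β2-B) p509205, (β3) p510277).  PROOF-ONLY; ADDITIVE.  Consumed BY NAME:
abc-iut-w6-d037's `PowDiagonalBase.coprimePullLaw_of_perfection`, `Prop42Sub.prop42_iii_mkOfModelCanonical_of_laws`, `isMuSaturated_of_bZero_generator`;
abc-iut-L2-t3's comap kits (`phiZero_comap_eq`, `exists_units_generator_of_charTrivial_comap` — abc-iut-L2-d2's MU-TORSION (M3) + character adapter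
under `GaloisAction.comap`), (β2-A)'s model and transition formula `Φ₀_map_hom_eq_sub`, (β2-B)'s A10, (α)'s `mkOfDenseQuotientTemperoid_galoisSurj_natural`,
abc-iut-L2-t2's `ρ_eq_of_mem_closure_rep_lvl`, abc-iut-L3's `BTemp.quotientObj` / `exists_hom_quotientObj` / `ConnectedPart.exists_hom_from_isGaloisObj`.
* §1 `Φ₀_map_disjoint_sub`, **`coprimePullLaw_sub`** (hDSpull — NO hypothesis), `rootLaw_galois_sub` (hR — modulo (LEV), from (β2-B) A10);
* §2 **`exists_galoisCover_level_charTrivial_sub`** (modulo (LEV)): every connected tempered `G`-set is dominated by a GALOIS `G`-covering of reading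
  level `≥ m` all of whose stabilisers have trivial index-`m` character coordinate (cover `G/(Stab_G(y₀) ∩ G ∩ (kumLevel_m ∩ Ker χ_m))`, then a Galois
  object; no countability bookkeeping — `G` tempered);
* §3 **`levelSaturation_sub`** — the level-wise `μ_K`-saturation law at the restricted tower (comap MU-TORSION kit at the coset re-presentation
  `reprG A^bs`), `refinementLaw_sub`;
* §4 the KNIT **`prop42_iii_mkOfDenseQuotientTemperoid_sub`** — [EtTh] Prop. 4.2 (iii) AS TYPED for the §4 setting over `B^temp(G)⁰` of ANY dense
  `ψ : Π^tp_X → G` at the restricted tower (trivial `(N,H)`-slot), every Frobenius-trivial Galois-based anchor — modulo (LEV) ONLY; and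
  **`prop42_iii_settingClosureRange`**: at `settingClosureRange R S X φ ⊤ M` for EVERY continuous `φ : Π^tp_X → Compat₃′`, modulo (LEV) on
  `closure(Im φ)` — «`N`-th roots EXIST at the carrier a genuine `φ` can enter» (`nonempty_nthRoot_settingClosureRange`).
HONEST FRAMING: class-(b) combinatorial design carrier (NOT the tempered Frobenioid of a Tate curve); (LEV) displayed (true in shape for the genuine
`φ`, vacuously false for level-poor images — finding F-L2t3g10-2 / J-LEV); the CONSTRUCTION of the genuine `φ` stays with §1/§2 (L); trivial
`(N,H)`-slot; nothing here bears on, or takes a side on, the disputed [IUTchIII] Cor. 3.12; nothing here asserts abc proved or refuted; typed ≠ proved.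
-/

noncomputable section

namespace Literature.AnabelianGeometry.EtaleTheta

open CategoryTheory Opposite Function Literature.AlgebraicGeometry.Frobenioids Literature.AnabelianGeometry.SemiGraphs
  Literature.AnabelianGeometry.SemiGraphs.GaloisObjects Literature.AlgebraicGeometry.Frobenioids.QuasiTemperoid
  LogDivisorModel LogDivisorModel.GaloisAction LogDivisorTower TateTowerKummerTwistRShear LogDivisorModel.TateTowerThetaTwist

namespace ThetaTwistTowerSubgroup

open ThetaTwistTowerTempered
open TateTowerKummerTwist (M Cst N N_dvd_M N_dvd_N)

variable (G : Subgroup (Compat 3 thetaShear)) (hG : IsTempered G)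
  (R S : ((ConnectedPart (BTemp G))ᵒᵖ ⥤ CommMonCat.{0}) → Prop)

/-! ## §1 hDSpull (no hypothesis) and hR (modulo (LEV)) at the restricted tower -/

/-- Along every covering map of `B^temp(G)⁰` the transition of `Φ₀` carries support-disjoint pairs to support-disjoint pairs (pull back, then
`(−)^{eN}`; (β2-A)'s `Φ₀_map_hom_eq_sub`). [cite: MochizukiEtTh2009, Def 4.1 (i) p.312 (PDF p.86)] -/
theorem Φ₀_map_disjoint_sub {A B : ConnectedPart (BTemp G)} (f : B ⟶ A) (a b : (dmG G).Φ₀.obj (op A))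
    (h : ∀ (s : (gset A).V) (x : TateTowerTheta.Idx),
      TateTowerTheta.coord (φG G) (gset A) s x a = 1 ∨ TateTowerTheta.coord (φG G) (gset A) s x b = 1)
    (s : (gset B).V) (x : TateTowerTheta.Idx) :
    TateTowerTheta.coord (φG G) (gset B) s x (((dmG G).Φ₀.map f.op).hom a) = 1 ∨
      TateTowerTheta.coord (φG G) (gset B) s x (((dmG G).Φ₀.map f.op).hom b) = 1 := by
  rw [Φ₀_map_hom_eq_sub, Φ₀_map_hom_eq_sub, TateTowerTheta.coord_pow_eq_one_iff (φG G) _ (eN_lvlG_pos G f.op),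
    TateTowerTheta.coord_pow_eq_one_iff (φG G) _ (eN_lvlG_pos G f.op)]
  exact TateTowerTheta.phiZeroPull_disjoint (φG G) _ _ a b h s x

/-- **The coprimality-pull-back law `hDSpull` HOLDS at the restricted tower** — NO hypothesis. [cite: MochizukiEtTh2009, Def 4.1 (i) p.312 (PDF p.86)] -/
theorem coprimePullLaw_sub : (temperedFrobenioidSub G hG R S).CoprimePullLaw :=
  TemperedFrobenioid.PowDiagonalBase.coprimePullLaw_of_perfection (hpfSubSmall G hG) (powDiagonalBaseSub G hG) _ _ _ R S
    fun f α β hαβ η hηα hηβ =>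
      TateTowerTheta.perfection_map_coprime (φG G) _ _
        (fun a b h => Φ₀_map_disjoint_sub G ((toConnG G hG).map ((equivConnG G hG).inverse.map f)) a b h) α β hαβ η hηα hηβ

/-- **The E2 root law `hR` in binder shape (`IG := «Galois»`) at the restricted tower, modulo (LEV)** ((β2-B) A10, `Φ` perfect, weak-vocabulary `hTF`).
[cite: MochizukiEtTh2009, Prop 4.2 (iii) p.315 (PDF p.89)] -/
theorem rootLaw_galois_sub
    (hlev : ∀ n m : ℕ, (∀ g : G, (g : Compat 3 thetaShear) ∈ closureC 3 thetaShear n → (g : Compat 3 thetaShear) ∈ kumLevelC₃ m) → m ≤ n)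
    (N' : ℕ+) (A : ConnectedPart (BTemp G)) (hA : IsGaloisObj A.obj) (f : (temperedFrobenioidSub G hG R S).ratFnFunctor.obj (op A)) :
    ∃ (A' : ConnectedPart (BTemp G)) (_ : IsGaloisObj A'.obj) (c : A' ⟶ A) (g : (temperedFrobenioidSub G hG R S).ratFnFunctor.obj (op A')),
      g ^ (N' : ℕ) = pull (temperedFrobenioidSub G hG R S).ratFnFunctor c f :=
  (temperedFrobenioidSub G hG R S).rootLaw_of_baseRootLaw' _ (hPSub G hG R S)
    (fun _ _ hN => RealifiedDivisorMonoids.pow_injective_ΦR_gp_treeVocabWeak _ _ hN)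
    (baseRootLaw_galois_temperedFrobenioidSub G hG R S hlev) N' A hA f

/-! ## §2 Deep Galois `G`-coverings with `μ`-trivialising stabilisers (modulo (LEV)) -/

include hG in
/-- **Every connected tempered `G`-set `Y` is dominated by a GALOIS `G`-covering `Y′ → Y` of reading level `≥ m` every stabiliser of which has trivial
index-`m` cyclotomic-character coordinate** (modulo (LEV)): dominate `Y` by `G/(Stab_G(y₀) ∩ G ∩ (kumLevel_m ∩ Ker χ_m))` (open), then by a Galois object
([SemiAnbd] Rmk. 3.1.3, `G` tempered); `χ_m` takes values in the ABELIAN `(ℤ/M_m)ˣ`, so its triviality passes to conjugate stabilisers.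
[cite: MochizukiEtTh2009, Def 3.3 (ii) p.299 (PDF p.73)] -/
theorem exists_galoisCover_level_charTrivial_sub
    (hlev : ∀ n m : ℕ, (∀ g : G, (g : Compat 3 thetaShear) ∈ closureC 3 thetaShear n → (g : Compat 3 thetaShear) ∈ kumLevelC₃ m) → m ≤ n)
    (Y : ConnectedPart (BTemp G)) (m : ℕ) :
    ∃ (Y' : ConnectedPart (BTemp G)) (_ : IsGaloisObj Y'.obj) (_ : Y' ⟶ Y),
      m ≤ lvlG G Y' ∧ ∀ (s : Y'.obj.obj.V) (g : G), Y'.obj.obj.ρ g s = s → ((g : Compat 3 thetaShear) : Grp 3 thetaShear).right.1 m = 1 := by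
  obtain ⟨y₀⟩ := BTempConnected.nonempty_of_isConnectedObj Y.obj Y.property
  -- the index-`m` character coordinate as a continuous homomorphism on `Compat₃′`
  let χm : Compat 3 thetaShear →* (ZMod (M m))ˣ :=
    ((Pi.evalMonoidHom (fun n : ℕ => (ZMod (M n))ˣ) m).comp (MonoidHom.fst Cst (Multiplicative ℤ))).comp
      (SemidirectProduct.rightHom.comp (compat 3 thetaShear).subtype)
  have hχm : ∀ g : Compat 3 thetaShear, χm g = (g : Grp 3 thetaShear).right.1 m := fun _ => rfl
  have hχm_cont : Continuous χm := (TateTowerKummerTwistRShear.continuous_coordC 3 thetaShear m).comp continuous_subtype_val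
  -- the open subgroup `H := Stab_G(y₀) ∩ (kumLevel_m ∩ Ker χ_m) ∩ G`
  let H : Subgroup G := stabilizerSubgroup Y.obj y₀ ⊓ (kumLevelC₃ m ⊓ χm.ker).comap G.subtype
  have hH : IsOpen (H : Set G) :=
    (isOpen_stabilizerSubgroup Y.obj y₀).inter
      (((isOpen_kumLevelC₃ m).inter ((isOpen_discrete {(1 : (ZMod (M m))ˣ)}).preimage hχm_cont)).preimage continuous_subtype_val)
  let Y₁ : ConnectedPart (BTemp G) := ⟨BTemp.quotientObj G hG H hH, isConnectedObj_quotientObj hG H hH⟩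
  have hex := exists_hom_quotientObj hG H hH (X := Y.obj) y₀ fun k hk => mem_stabilizerSubgroup_iff.mp (Subgroup.mem_inf.mp hk).1
  let f₁ : Y₁ ⟶ Y := ObjectProperty.homMk hex.choose
  -- the reading level of `Y₁` is at least `m` — (LEV)
  have hm₁ : m ≤ lvlG G Y₁ := hlev _ _ fun g hg =>
    ((quotientObj_ρ_one_eq_iff hG H hH g).1
      (LogDivisorTower.ρ_eq_of_mem_closure_rep_lvl (L := levelsC 3 thetaShear) id heC hbC G Y₁ hg _)).2.1
  -- dominate `Y₁` by a Galois object
  have hex₂ := ConnectedPart.exists_hom_from_isGaloisObj hG Y₁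
  let Y' : ConnectedPart (BTemp G) := hex₂.choose
  have hY' : IsGaloisObj Y'.obj := hex₂.choose_spec.1
  let g₁ : Y' ⟶ Y₁ := hex₂.choose_spec.2.some
  refine ⟨Y', hY', g₁ ≫ f₁, hm₁.trans (lvlG_le_of_hom G g₁), fun s g hgs => ?_⟩
  -- stabilisers of `Y′` map into stabilisers of `Y₁ = G/H`, i.e. into conjugates of `H ⊆ G ∩ Ker χ_m`
  have hq : Y₁.obj.obj.ρ g (g₁.hom.hom.hom s) = g₁.hom.hom.hom s := by
    rw [← BTempConnected.hom_ρ g₁.hom g s, hgs]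
  obtain ⟨k, hk⟩ : ∃ k : G, (k : G ⧸ H) = g₁.hom.hom.hom s := Quot.exists_rep (g₁.hom.hom.hom s)
  rw [← hk, quotientObj_ρ_mk hG H hH g k] at hq
  have hmem : k⁻¹ * g * k ∈ H := by
    have h1 : (g * k)⁻¹ * k ∈ H := QuotientGroup.eq.mp hq
    have h2 := H.inv_mem h1
    rw [mul_inv_rev, inv_inv, ← mul_assoc] at h2
    exact h2
  have h3 : (χm (k : Compat 3 thetaShear))⁻¹ * χm (g : Compat 3 thetaShear) * χm (k : Compat 3 thetaShear) = 1 := by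
    rw [← map_inv, ← map_mul, ← map_mul]
    exact hmem.2.2
  rw [mul_comm, ← mul_assoc, mul_inv_cancel, one_mul] at h3
  rw [← hχm (g : Compat 3 thetaShear)]
  exact h3

/-! ## §3 Level-wise `μ_K`-saturation and the refinement law at the restricted tower -/

/-- Whatever fixes a point of the coset re-presentation fixes its image in the covering. [cite: MochizukiFrdII2008, Ex 1.3 (i) p.11] -/
theorem ρ_reprGIso_hom_eq_of_ρ_eq (A : ConnectedPart (BTemp G)) (s : (gset (reprG G hG A)).V) (g : G)
    (hgs : (gset (reprG G hG A)).ρ g s = s) : A.obj.obj.ρ g ((reprGIso G hG A).hom.hom.hom.hom s) = (reprGIso G hG A).hom.hom.hom.hom s := by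
  rw [← BTempConnected.hom_ρ (reprGIso G hG A).hom.hom g s]
  exact congrArg _ hgs

/-- Bridge from the comapped level action to the Def. 3.6 (i) datum of the restricted model: `div₀ b = 1` in `B₀(reprG A^bs)` gives
`Div^Λ b = 1` in `B₀^Λ(A^bs) = B₀(reprG A^bs)` (abc-iut-L2-t2's `ofTower_comap_div₀` and `ofRlfZWeak_divΛ_apply`, both definitional; stated once with
the element a variable so that no rewriting under unit coercions is needed downstream). [cite: MochizukiEtTh2009, Def 3.6 p.302 (PDF p.76)] -/
theorem divΛ_baseOp_eq_one_of_divZeroHom_eq_one (A : (temperedFrobenioidSub G hG R S).category)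
    (b : ↥(((towerC₃sf.act (lvlG G (reprG G hG A.base))).comap G.subtype).bZero (gset (reprG G hG A.base))))
    (hb : ((towerC₃sf.act (lvlG G (reprG G hG A.base))).comap G.subtype).divZeroHom (gset (reprG G hG A.base)) b = 1) :
    (RealifiedDivisorMonoids.ofRlfZWeak (dmSubSmall G hG) (hpfSubSmall G hG)).divΛ
      ((temperedFrobenioidSub G hG R S).baseOp (op A.base)) b = 1 := by
  have e : (RealifiedDivisorMonoids.ofRlfZWeak (dmSubSmall G hG) (hpfSubSmall G hG)).divΛ
        ((temperedFrobenioidSub G hG R S).baseOp (op A.base)) b =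
      EtaleTheta.gpMap ((toRlfNatTransWeak (dmSubSmall G hG).Φ₀ (hpfSubSmall G hG)).app
        ((temperedFrobenioidSub G hG R S).baseOp (op A.base))).hom
        (((towerC₃sf.act (lvlG G (reprG G hG A.base))).comap G.subtype).divZeroHom (gset (reprG G hG A.base)) b) := rfl
  rw [e]
  simp only [hb]
  exact map_one _

/-- **THE LEVEL-WISE `μ_K`-SATURATION LAW at the restricted tower**: for `K ∣ N_m`, every object over a `G`-covering of reading level `≥ m` all of whose
stabilisers have trivial index-`m` character coordinate is `μ_K`-saturated — abc-iut-L2-t3's comap MU-TORSION kit (abc-iut-L2-d2's (M3) + character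
adapter under `GaloisAction.comap`) READ ON `reprG(A^bs)`, fed to abc-iut-w6-d037's `isMuSaturated_of_bZero_generator`. [cite: MochizukiEtTh2009, Def 4.1 (iv) p.313 (PDF p.87)] -/
theorem levelSaturation_sub (K : ℕ+) (m : ℕ) (A : (temperedFrobenioidSub G hG R S).category) (hK : (K : ℕ) ∣ (N m : ℕ))
    (hm : m ≤ lvlG G A.base)
    (hχ : ∀ (s : A.base.obj.obj.V) (g : G), A.base.obj.obj.ρ g s = s → ((g : Compat 3 thetaShear) : Grp 3 thetaShear).right.1 m = 1) :
    (temperedFrobenioidSub G hG R S).IsMuSaturated A K := by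
  have hS := isConnectedGSet_gsetG G (reprG G hG A.base)
  obtain ⟨s₀⟩ := hS.1
  have hm' : m ≤ lvlG G (reprG G hG A.base) := by rw [lvlG_reprG]; exact hm
  obtain ⟨u, hdiv, hord, hgen⟩ := exists_units_generator_of_charTrivial_comap G.subtype (lvlG G (reprG G hG A.base)) hS s₀ hm'
    (fun g hg => hχ _ g (ρ_reprGIso_hom_eq_of_ρ_eq G hG A.base s₀ g hg)) K.pos hK
  have hζ1 := divΛ_baseOp_eq_one_of_divZeroHom_eq_one G hG R S A _ hdiv
  exact (temperedFrobenioidSub G hG R S).isMuSaturated_of_bZero_generator A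
    ((hypotheses_temperedFrobenioidSub G hG R S).isDivisorial A.base) K u hζ1 hord (fun b _ hb => hgen b hb)

include hG in
/-- **`hE` ([FrdII] Rmk. 2.2.1, trivial `(N,H)`-slot) at the restricted tower, modulo (LEV)**: every Frobenius-trivial object with Galois base has a
`μ_K`-saturated Galois-based pull-back refinement (§2 + the pull-back morphism `(1, b, 0, 1)` + `levelSaturation_sub`).
[cite: MochizukiEtTh2009, Prop 4.2 (iii) p.316 (PDF p.90)] -/
theorem refinementLaw_sub
    (hlev : ∀ n m : ℕ, (∀ g : G, (g : Compat 3 thetaShear) ∈ closureC 3 thetaShear n → (g : Compat 3 thetaShear) ∈ kumLevelC₃ m) → m ≤ n) :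
    ∀ (K : ℕ+) (A' : (temperedFrobenioidSub G hG R S).category),
      PreFrobenioid.IsFrobeniusTrivial (temperedFrobenioidSub G hG R S).toElem A' → IsGaloisObj A'.base.obj →
      ∃ (A'' : (temperedFrobenioidSub G hG R S).category) (ψ : A'' ⟶ A'),
        PreFrobenioid.IsPullbackMorphism (temperedFrobenioidSub G hG R S).toElem ψ ∧ IsGaloisObj A''.base.obj ∧
        (temperedFrobenioidSub G hG R S).IsMuSaturated A'' K ∧ True := by
  intro K A' _ _
  obtain ⟨Y', hY', b, hm, hχ⟩ := exists_galoisCover_level_charTrivial_sub G hG hlev A'.base K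
  obtain ⟨W, δ, hW, hδ⟩ := (temperedFrobenioidSub G hG R S).exists_isPullbackMorphism_over_baseHom
    (hypotheses_temperedFrobenioidSub G hG R S).isDivisorial A' b
  subst hW
  exact ⟨W, δ, hδ, hY', levelSaturation_sub G hG R S K K W (Nat.dvd_factorial K.pos (Nat.le_succ _)) hm hχ, trivial⟩

/-! ## §4 The knit: [EtTh] Prop. 4.2 (iii) AS TYPED over `B^temp(G)⁰` (dense `ψ`) and at `settingClosureRange` — modulo (LEV) only -/

section Dense

variable {K : Type} [Field K] (X : TemperedArithmeticGroup.{0} K) (ψ : X.Pi →ₜ* G) (hψ : DenseRange ψ)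

/-- **[EtTh] Prop. 4.2 (iii) AS TYPED — POSITIVE at the theta tower restricted to a tempered subgroup `G ≤ Compat₃′`, for the §4 setting of ANY
dense-range `ψ : Π^tp_X → G`** ((α) `mkOfDenseQuotientTemperoid`, trivial `(N,H)`-slot, every Frobenius-trivial Galois-based anchor), MODULO (LEV) ON `G`
ONLY — `Φ` divisorial, hDSpull, hE's pull-backs and hS (`mkOfDenseQuotientTemperoid_galoisSurj_natural`) are theorems; hR and the deep coverings use (LEV).
[cite: MochizukiEtTh2009, Prop 4.2 (iii) p.314 (PDF p.88)] -/
theorem prop42_iii_mkOfDenseQuotientTemperoid_sub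
    (hlev : ∀ n m : ℕ, (∀ g : G, (g : Compat 3 thetaShear) ∈ closureC 3 thetaShear n → (g : Compat 3 thetaShear) ∈ kumLevelC₃ m) → m ≤ n)
    (A₀ : (temperedFrobenioidSub G hG R S).category)
    (hA₀ : PreFrobenioid.IsFrobeniusTrivial (temperedFrobenioidSub G hG R S).toElem A₀) (hA₀' : IsGaloisObj A₀.base.obj) :
    (BiKummerSetting.mkOfDenseQuotientTemperoid X hG ψ hψ (temperedFrobenioidSub G hG R S) rfl (hPSub G hG R S)
        (fun _ _ _ => True) A₀ hA₀ hA₀').Prop42_iii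
      (fun {_ _} χ x => (temperedFrobenioidSub G hG R S).pullFracModel χ x) :=
  BiKummerSetting.Prop42Sub.prop42_iii_mkOfModelCanonical_of_laws X (temperedFrobenioidSub G hG R S) rfl (hPSub G hG R S) _ _ _ _ A₀ hA₀ hA₀'
    (hypotheses_temperedFrobenioidSub G hG R S).isDivisorial
    (fun e _ _ hab y hya hyb => coprimePullLaw_sub G hG R S e hab y hya hyb)
    (rootLaw_galois_sub G hG R S hlev) (refinementLaw_sub G hG R S hlev)
    (BiKummerSetting.mkOfDenseQuotientTemperoid_galoisSurj_natural X hG ψ hψ (temperedFrobenioidSub G hG R S) rfl (hPSub G hG R S)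
      (fun _ _ _ => True) A₀ hA₀ hA₀')

end Dense

section ClosureRange

variable {K : Type} [Field K] (X : TemperedArithmeticGroup.{0} K) (φ : X.Pi →ₜ* Compat 3 thetaShear)
  (R' S' : ((ConnectedPart (BTemp (closureRange φ)))ᵒᵖ ⥤ CommMonCat.{0}) → Prop) (Mₒ : OpenNormalSubgroup (closureRange φ))

set_option maxHeartbeats 1600000 in
/-- **[EtTh] Prop. 4.2 (iii) AS TYPED at `settingClosureRange R S X φ ⊤ M` — for EVERY continuous `φ : Π^tp_X → Compat₃′`, modulo (LEV) on
`closure(Im φ)` only**: the Prop. 4.2 (iii) positive instance in the true group-side shape.  (Elaboration: unfolding `settingClosureRange` down to the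
canonical model needs a raised heartbeat budget; the proof is the generic knit BY NAME.) [cite: MochizukiEtTh2009, Prop 4.2 (iii) p.314 (PDF p.88)] -/
theorem prop42_iii_settingClosureRange
    (hlev : ∀ n m : ℕ, (∀ g : closureRange φ, (g : Compat 3 thetaShear) ∈ closureC 3 thetaShear n →
      (g : Compat 3 thetaShear) ∈ kumLevelC₃ m) → m ≤ n) :
    (settingClosureRange X φ R' S' (fun _ _ _ => True) Mₒ).Prop42_iii
      (fun {_ _} χ x => (tfClosureRange X φ R' S').pullFracModel χ x) :=
  prop42_iii_mkOfDenseQuotientTemperoid_sub (closureRange φ) (isTempered_closureRange_compat₃ X φ) R' S' X (toClosureRange φ)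
    (denseRange_toClosureRange φ) hlev
    ((tfClosureRange X φ R' S').quotConnZeroObj (isTempered_closureRange_compat₃ X φ) Mₒ)
    ((tfClosureRange X φ R' S').isFrobeniusTrivial_quotConnZeroObj (isTempered_closureRange_compat₃ X φ) Mₒ)
    ((tfClosureRange X φ R' S').isGaloisObj_quotConnZeroObj_base (isTempered_closureRange_compat₃ X φ) Mₒ)

set_option maxHeartbeats 1600000 in
/-- **ROOTS AS THEOREMS in the true shape**: every fraction pair over the anchor of `settingClosureRange` has an `N`-th root object for every `N ≥ 1`,
modulo (LEV) on `closure(Im φ)`. [cite: MochizukiEtTh2009, Prop 4.2 (iii) p.314 (PDF p.88)] -/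
theorem nonempty_nthRoot_settingClosureRange
    (hlev : ∀ n m : ℕ, (∀ g : closureRange φ, (g : Compat 3 thetaShear) ∈ closureC 3 thetaShear n →
      (g : Compat 3 thetaShear) ∈ kumLevelC₃ m) → m ≤ n) (N' : ℕ+)
    (f : (settingClosureRange X φ R' S' (fun _ _ _ => True) Mₒ).biratUnits (settingClosureRange X φ R' S' (fun _ _ _ => True) Mₒ).Aodot)
    {B : (settingClosureRange X φ R' S' (fun _ _ _ => True) Mₒ).C}
    (P : (settingClosureRange X φ R' S' (fun _ _ _ => True) Mₒ).FractionPair f B) :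
    Nonempty ((settingClosureRange X φ R' S' (fun _ _ _ => True) Mₒ).NthRoot f P N'
      (fun χ x => (tfClosureRange X φ R' S').pullFracModel χ x)) :=
  prop42_iii_settingClosureRange X φ R' S' Mₒ hlev f P N'

end ClosureRange

end ThetaTwistTowerSubgroup

end Literature.AnabelianGeometry.EtaleTheta

end
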